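import Literature.Probability.RandomPlanarGeometry.PlaneNonIntersectionUpperBound
import Mathlib.Analysis.Complex.ExponentialBounds
import HarnessLib

/-!
# Planar simple random walk: a Gaussian lower bound for the transition probabilities, and the
# killed Green function at distance `r`

Fifth proof file of the `PlaneNonIntersection` story (named fact
`LSW2001_srw_nonIntersection_five_eighths`, `PlaneNonIntersection.lean`), second input of the
`k^{-1/2}` programme (Lawler 1991, (3.29) via §3.6): the estimate (3.27),
`G_λ(x) ≥ c e^{-|x|²(1-λ)/8}` for the Green function of the walk killed at rate `1 - λ`, which in
the book comes from the local central limit theorem. Here it is proved by counting, with absurd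
but explicit constants, in the finite form used downstream:

* **rotation bijection** (`rotEquiv`): a planar step sequence is a pair of Boolean sequences
  (orientation bit, orientation bit twisted by the axis), under which the two diagonal
  coordinates `x + y`, `x - y` are independent `±1` walks; hence the **product formula**
  `c_n(z) = #{S = z₀ + z₁} · #{S' = z₀ - z₁}` (`count_two_eq_card_mul_card`);
* **binomial ratio** (`choose_add_ge_mul_exp`): `C(n, m + w) ≥ C(n, m) e^{-2w²/(m+1)}` for
  `2m ≤ n`, `4w ≤ m + 1` (product formula and `1 - x ≥ e^{-2x}` on `[0, 1/2]`);
* **Gaussian lower bound** (`count_two_ge`): for `4|z₀ ± z₁| + 6 ≤ i` and the right parity,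
  `c_i(z) ≥ 4^i e^{-4} e^{-4|z|²/i} / (2(i+1))`, i.e. `p_i(z) ≥ e^{-4 - 4|z|²/i}/(2(i+1))`;
* **killed Green function** (`sum_pow_mul_prob_ge`): for `0 ≤ λ ≤ 1`, `|z|² ≤ r²` and a horizon
  `L ≥ r²/32 + 1200`, `Σ_{i ≤ L} λ^i p_i(z) ≥ 4^{-2000} λ^{r²/32 + 1200}` — a window of `q = r²/256`
  times of order `r²/64 … r²/42` for `r ≥ 600`, one straight path for `r < 600`.

Everything is folklore (the statements are weak forms of the local central limit theorem,
Lawler 1991 §1.2, and of (3.27) ibid.).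

## References

* G. F. Lawler, *Intersections of Random Walks*, Birkhäuser 1991, §1.2 (local central limit
  theorem), proof of (3.27) [Lawler1991].
-/

noncomputable section

open Finset Real Literature.Probability.LatticeModels Literature.Probability.LatticeModels.SRW
open scoped BigOperators

namespace Literature.Probability.RandomPlanarGeometry

namespace PlaneNonIntersection

/-! ### The rotation bijection and the product formula -/

/-- Boolean bookkeeping: the axis is recovered from the two bits. [folklore] -/
theorem ite_beq_decide_eq (a : Fin 2) (b : Bool) :
    (if (b == decide (a = 0)) = b then (0 : Fin 2) else 1) = a := by
  fin_cases a <;> cases b <;> decide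

/-- **Rotation bijection**: a planar step sequence `ω` is the pair `(β, γ)` of Boolean sequences
`βᵢ` = orientation bit of `ωᵢ`, `γᵢ = (βᵢ == [axis of ωᵢ = 0])`; the diagonal coordinates
`ω(j)₀ + ω(j)₁` and `ω(j)₀ - ω(j)₁` are the `±1` walks `S_β(j)`, `S_γ(j)`
(`pos_apply_zero_add_pos_apply_one`, `pos_apply_zero_sub_pos_apply_one`). [folklore] -/
def rotEquiv (n : ℕ) : StepSeq 2 n ≃ (Fin n → Bool) × (Fin n → Bool) where
  toFun ω := (fun i => (ω i).2, fun i => ((ω i).2 == decide ((ω i).1 = 0)))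
  invFun p := fun i => ((if p.2 i = p.1 i then (0 : Fin 2) else 1), p.1 i)
  left_inv ω := by
    funext i
    exact Prod.ext (ite_beq_decide_eq (ω i).1 (ω i).2) rfl
  right_inv p := by
    obtain ⟨β, γ⟩ := p
    refine Prod.ext rfl ?_
    funext i
    exact beq_decide_ite_eq (β i) (γ i)

/-- **Product formula**: `c_n(z) = #{β : S_β(n) = z₀ + z₁} · #{γ : S_γ(n) = z₀ - z₁}`. [folklore] -/
theorem count_two_eq_card_mul_card (n : ℕ) (z : Site 2) :
    count 2 n z = #{β : Fin n → Bool | signSum β n = z 0 + z 1} *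
      #{γ : Fin n → Bool | signSum γ n = z 0 - z 1} := by
  classical
  rw [count, ← Finset.card_product]
  refine Finset.card_equiv (rotEquiv n) fun ω => ?_
  simp only [Finset.mem_filter, Finset.mem_univ, true_and, Finset.mem_product, rotEquiv,
    Equiv.coe_fn_mk]
  rw [← pos_eq_endpoint, ← pos_apply_zero_add_pos_apply_one, ← pos_apply_zero_sub_pos_apply_one]
  constructor
  · intro h
    rw [h]
    exact ⟨rfl, rfl⟩
  · rintro ⟨h1, h2⟩
    have h3 : pos ω n 0 = z 0 := by omega
    have h4 : pos ω n 1 = z 1 := by omega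
    funext c
    fin_cases c
    · exact h3
    · exact h4

/-- `#{β : S_β(n) = 2t - n} = C(n, t)`: the `±1` paths ending at `2t - n` are those with `t`
up-steps. [folklore] -/
theorem card_filter_signSum_eq_choose (n t : ℕ) :
    #{β : Fin n → Bool | signSum β n = 2 * (t : ℤ) - n} = n.choose t := by
  rw [← card_filter_card_upSteps_eq n t]
  congr 1
  refine Finset.filter_congr fun β _ => ?_
  rw [signSum_self_eq]
  omega

/-- Negation symmetry of the endpoint counts. [folklore] -/
theorem card_filter_signSum_eq_neg (n : ℕ) (s : ℤ) :
    #{β : Fin n → Bool | signSum β n = -s} = #{β : Fin n → Bool | signSum β n = s} := by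
  refine Finset.card_bijective (fun β i => !β i)
    (Function.Involutive.bijective fun β => by funext i; simp) fun β => ?_
  simp only [Finset.mem_filter, Finset.mem_univ, true_and, signSum_not]
  omega

/-! ### The binomial ratio -/

/-- `e^{-2x} ≤ 1 - x` for `0 ≤ x ≤ 1/2` (from `1 + 2x ≤ e^{2x}` and `1 ≤ (1 - x)(1 + 2x)`).
[folklore] -/
theorem exp_neg_two_mul_le_one_sub {x : ℝ} (hx0 : 0 ≤ x) (hx : x ≤ 1 / 2) :
    Real.exp (-(2 * x)) ≤ 1 - x := by
  have h1 : 2 * x + 1 ≤ Real.exp (2 * x) := Real.add_one_le_exp _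
  have h2 : Real.exp (-(2 * x)) ≤ (2 * x + 1)⁻¹ := by
    rw [Real.exp_neg]
    exact inv_anti₀ (by positivity) h1
  have h3 : (2 * x + 1)⁻¹ ≤ 1 - x := by
    rw [inv_eq_one_div, div_le_iff₀ (by positivity)]
    nlinarith
  exact h2.trans h3

/-- **Binomial ratio**: `C(n, m + w) ≥ C(n, m) · e^{-2w²/(m+1)}` for `2m ≤ n` and `4w ≤ m + 1`
(product formula `C(n, k+1)(k+1) = C(n, k)(n-k)`, `(m-w)/(m+w+1) ≥ 1 - (2w+1)/(m+1) ≥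
e^{-2(2w+1)/(m+1)}`, `Σ_{s<w} (2s+1) = w²`). [folklore] -/
theorem choose_add_ge_mul_exp (n m : ℕ) (h2m : 2 * m ≤ n) :
    ∀ w : ℕ, 4 * w ≤ m + 1 →
      (n.choose m : ℝ) * Real.exp (-(2 * (w : ℝ) ^ 2 / (m + 1))) ≤ (n.choose (m + w) : ℝ)
  | 0, _ => by simp
  | w + 1, hw => by
      have ih := choose_add_ge_mul_exp n m h2m w (by omega)
      have hmw : m + w ≤ n := by omega
      have hrec : (n.choose (m + w + 1) : ℝ) * ((m : ℝ) + w + 1) =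
          (n.choose (m + w) : ℝ) * ((n : ℝ) - (m + w)) := by
        have h := Nat.choose_succ_right_eq n (m + w)
        have h' : ((n.choose (m + w + 1) * (m + w + 1) : ℕ) : ℝ) =
            ((n.choose (m + w) * (n - (m + w)) : ℕ) : ℝ) := by exact_mod_cast h
        push_cast [Nat.cast_sub hmw] at h'
        linarith [h']
      have hm : (0 : ℝ) < (m : ℝ) + 1 := by positivity
      have hx0 : (0 : ℝ) ≤ (2 * (w : ℝ) + 1) / (m + 1) := by positivity
      have hw' : (4 : ℝ) * (w + 1) ≤ m + 1 := by exact_mod_cast hw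
      have hx : (2 * (w : ℝ) + 1) / (m + 1) ≤ 1 / 2 := by
        rw [div_le_iff₀ hm]
        linarith
      -- the new factor
      have hfac : Real.exp (-(2 * ((2 * (w : ℝ) + 1) / (m + 1)))) ≤
          ((m : ℝ) - w) / ((m : ℝ) + w + 1) := by
        refine (exp_neg_two_mul_le_one_sub hx0 hx).trans ?_
        rw [le_div_iff₀ (by positivity)]
        have h1 : (1 - (2 * (w : ℝ) + 1) / (m + 1)) * ((m : ℝ) + w + 1) =
            ((m : ℝ) + w + 1) - (2 * w + 1) * (((m : ℝ) + w + 1) / (m + 1)) := by ring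
        rw [h1]
        have h2 : (1 : ℝ) ≤ ((m : ℝ) + w + 1) / (m + 1) := by
          rw [le_div_iff₀ hm]
          have : (0 : ℝ) ≤ w := Nat.cast_nonneg w
          linarith
        nlinarith
      have hnm : ((m : ℝ) - w) ≤ (n : ℝ) - (m + w) := by
        have : (2 * m : ℝ) ≤ n := by exact_mod_cast h2m
        linarith
      have hexp : Real.exp (-(2 * ((w + 1 : ℕ) : ℝ) ^ 2 / (m + 1))) =
          Real.exp (-(2 * (w : ℝ) ^ 2 / (m + 1))) *
            Real.exp (-(2 * ((2 * (w : ℝ) + 1) / (m + 1)))) := by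
        rw [← Real.exp_add]
        congr 1
        push_cast
        ring
      have hpos : (0 : ℝ) < (m : ℝ) + w + 1 := by positivity
      calc (n.choose m : ℝ) * Real.exp (-(2 * ((w + 1 : ℕ) : ℝ) ^ 2 / (m + 1)))
          = (n.choose m : ℝ) * Real.exp (-(2 * (w : ℝ) ^ 2 / (m + 1))) *
              Real.exp (-(2 * ((2 * (w : ℝ) + 1) / (m + 1)))) := by rw [hexp, mul_assoc]
        _ ≤ (n.choose (m + w) : ℝ) * (((m : ℝ) - w) / ((m : ℝ) + w + 1)) :=
            mul_le_mul ih hfac (Real.exp_pos _).le (Nat.cast_nonneg _)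
        _ ≤ (n.choose (m + w) : ℝ) * (((n : ℝ) - (m + w)) / ((m : ℝ) + w + 1)) := by
            gcongr
        _ = (n.choose (m + w + 1) : ℝ) := by
            rw [mul_div_assoc', ← hrec, mul_div_assoc, div_self hpos.ne', mul_one]

/-! ### The Gaussian lower bound -/

/-- **One-dimensional local lower bound**: for `i ≥ 1`, `s` of the parity of `i` with
`4|s| + 6 ≤ i`, `#{β : S_β(i) = s} ≥ C(i, ⌊i/2⌋) e^{-(2s² + 2)/i}`. [folklore] -/
theorem mul_exp_le_card_filter_signSum_eq {i : ℕ} (hi : 1 ≤ i) (s : ℤ)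
    (hpar : Even ((i : ℤ) + s)) (hs : 4 * |s| + 6 ≤ (i : ℤ)) :
    (i.choose (i / 2) : ℝ) * Real.exp (-((2 * (s : ℝ) ^ 2 + 2) / i)) ≤
      #{β : Fin i → Bool | signSum β i = s} := by
  -- reduce to `s ≥ 0`
  wlog hs0 : 0 ≤ s generalizing s
  · have h := this (-s) (by obtain ⟨k, hk⟩ := hpar; exact ⟨(i : ℤ) - k, by omega⟩)
      (by rwa [abs_neg]) (by omega)
    rw [card_filter_signSum_eq_neg] at h
    simpa using h
  -- `s = 2t - i` with `t = ⌊i/2⌋ + w`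
  obtain ⟨k, hk⟩ := hpar
  have habs : |s| = s := abs_of_nonneg hs0
  rw [habs] at hs
  obtain ⟨w, hw⟩ : ∃ w : ℕ, (w : ℤ) = k - (i / 2 : ℕ) := ⟨(k - (i / 2 : ℕ)).toNat, by
    rw [Int.toNat_of_nonneg]; omega⟩
  have ht : s = 2 * (((i / 2 + w : ℕ) : ℤ)) - i := by push_cast; omega
  have h4w : 4 * w ≤ i / 2 + 1 := by omega
  have h2m : 2 * (i / 2) ≤ i := Nat.mul_div_le i 2
  rw [ht, card_filter_signSum_eq_choose i (i / 2 + w)]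
  refine le_trans ?_ (choose_add_ge_mul_exp i (i / 2) h2m w h4w)
  refine mul_le_mul_of_nonneg_left (Real.exp_le_exp.2 ?_) (Nat.cast_nonneg _)
  rw [neg_le_neg_iff]
  -- `2w²/(m+1) ≤ (2s²+2)/i`, from `2w ≤ s + 1` and `i ≤ 2(m+1)`
  have hi' : (0 : ℝ) < i := by exact_mod_cast hi
  have hm : (0 : ℝ) < ((i / 2 : ℕ) : ℝ) + 1 := by positivity
  have h2w : 2 * (w : ℝ) ≤ s + 1 := by
    have : 2 * (w : ℤ) ≤ s + 1 := by omega
    exact_mod_cast this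
  have him : (i : ℝ) ≤ 2 * (((i / 2 : ℕ) : ℝ) + 1) := by
    have : (i : ℤ) ≤ 2 * ((i / 2 : ℕ) + 1) := by omega
    exact_mod_cast this
  have hw0 : (0 : ℝ) ≤ w := Nat.cast_nonneg w
  have hsq : ((2 * (((i / 2 + w : ℕ) : ℤ)) - i : ℤ) : ℝ) = s := by rw [← ht]
  rw [hsq, div_le_div_iff₀ hm hi']
  have h4w2 : 4 * (w : ℝ) ^ 2 ≤ 2 * (s : ℝ) ^ 2 + 2 := by
    nlinarith [mul_self_le_mul_self (by positivity) h2w, sq_nonneg ((s : ℝ) - 1)]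
  have hwi : (w : ℝ) ^ 2 * i ≤ (w : ℝ) ^ 2 * (2 * (((i / 2 : ℕ) : ℝ) + 1)) :=
    mul_le_mul_of_nonneg_left him (sq_nonneg _)
  nlinarith [mul_le_mul_of_nonneg_right h4w2 hm.le]

/-- **Gaussian lower bound for the planar transition counts**: for `i ≥ 1`, `z` of the right
parity with `4|z₀ + z₁| + 6 ≤ i`, `4|z₀ - z₁| + 6 ≤ i`,
`c_i(z) ≥ 4^i e^{-4} e^{-4|z|²/i} / (2(i+1))`, i.e. `p_i(z) ≥ e^{-4-4|z|²/i}/(2(i+1))`.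
[folklore] -/
theorem count_two_ge {i : ℕ} (hi : 1 ≤ i) (z : Site 2) (hpar : Even ((i : ℤ) + (z 0 + z 1)))
    (h0 : 4 * |z 0 + z 1| + 6 ≤ (i : ℤ)) (h1 : 4 * |z 0 - z 1| + 6 ≤ (i : ℤ)) :
    (4 : ℝ) ^ i * Real.exp (-4) * Real.exp (-(4 * ((z 0 : ℝ) ^ 2 + (z 1 : ℝ) ^ 2) / i)) /
        (2 * ((i : ℝ) + 1)) ≤ count 2 i z := by
  have hi' : (0 : ℝ) < i := by exact_mod_cast hi
  have hpar' : Even ((i : ℤ) + (z 0 - z 1)) := by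
    obtain ⟨k, hk⟩ := hpar
    exact ⟨k - z 1, by omega⟩
  have hA := mul_exp_le_card_filter_signSum_eq hi (z 0 + z 1) hpar h0
  have hB := mul_exp_le_card_filter_signSum_eq hi (z 0 - z 1) hpar' h1
  have hC : (4 : ℝ) ^ i ≤ 2 * ((i : ℝ) + 1) * (i.choose (i / 2) : ℝ) ^ 2 := by
    exact_mod_cast four_pow_le_mul_choose_half_sq i
  have hC0 : (0 : ℝ) ≤ (i.choose (i / 2) : ℝ) := Nat.cast_nonneg _
  rw [count_two_eq_card_mul_card, Nat.cast_mul, div_le_iff₀ (by positivity)]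
  -- `(C e^{-a})(C e^{-b}) ≥ C² e^{-(a+b)}` and `a + b ≤ 4 + 4|z|²/i`
  have hprod : (i.choose (i / 2) : ℝ) * Real.exp (-((2 * ((z 0 + z 1 : ℤ) : ℝ) ^ 2 + 2) / i)) *
      ((i.choose (i / 2) : ℝ) * Real.exp (-((2 * ((z 0 - z 1 : ℤ) : ℝ) ^ 2 + 2) / i))) ≤
      (#{β : Fin i → Bool | signSum β i = z 0 + z 1} : ℝ) *
        #{γ : Fin i → Bool | signSum γ i = z 0 - z 1} :=
    mul_le_mul hA hB (by positivity) (Nat.cast_nonneg _)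
  have hexp : Real.exp (-4) * Real.exp (-(4 * ((z 0 : ℝ) ^ 2 + (z 1 : ℝ) ^ 2) / i)) ≤
      Real.exp (-((2 * ((z 0 + z 1 : ℤ) : ℝ) ^ 2 + 2) / i)) *
        Real.exp (-((2 * ((z 0 - z 1 : ℤ) : ℝ) ^ 2 + 2) / i)) := by
    rw [← Real.exp_add, ← Real.exp_add]
    refine Real.exp_le_exp.2 ?_
    push_cast
    have h4 : (4 : ℝ) / i ≤ 4 := by
      rw [div_le_iff₀ hi']
      have : (1 : ℝ) ≤ i := by exact_mod_cast hi
      linarith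
    have heq : -((2 * ((z 0 : ℝ) + z 1) ^ 2 + 2) / i) + -((2 * ((z 0 : ℝ) - z 1) ^ 2 + 2) / i) =
        -(4 * ((z 0 : ℝ) ^ 2 + (z 1 : ℝ) ^ 2) / i) - 4 / i := by
      field_simp
      ring
    rw [heq]
    linarith
  calc (4 : ℝ) ^ i * Real.exp (-4) * Real.exp (-(4 * ((z 0 : ℝ) ^ 2 + (z 1 : ℝ) ^ 2) / i))
      ≤ 2 * ((i : ℝ) + 1) * (i.choose (i / 2) : ℝ) ^ 2 *
          (Real.exp (-((2 * ((z 0 + z 1 : ℤ) : ℝ) ^ 2 + 2) / i)) *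
            Real.exp (-((2 * ((z 0 - z 1 : ℤ) : ℝ) ^ 2 + 2) / i))) := by
        rw [mul_assoc]
        exact mul_le_mul hC hexp (by positivity) (by positivity)
    _ = ((i.choose (i / 2) : ℝ) * Real.exp (-((2 * ((z 0 + z 1 : ℤ) : ℝ) ^ 2 + 2) / i)) *
          ((i.choose (i / 2) : ℝ) * Real.exp (-((2 * ((z 0 - z 1 : ℤ) : ℝ) ^ 2 + 2) / i)))) *
          (2 * ((i : ℝ) + 1)) := by ring
    _ ≤ _ := mul_le_mul_of_nonneg_right hprod (by positivity)

/-! ### A straight path: `c_{|z₀|+|z₁|}(z) ≥ 1` -/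

/-- The endpoint of a constant step sequence is a multiple of its step. [folklore] -/
theorem endpoint_const (v : Dir 2) (a : ℕ) : endpoint (fun _ : Fin a => v) = (a : ℤ) • stepVec v := by
  rw [endpoint, Finset.sum_const, Finset.card_univ, Fintype.card_fin, natCast_zsmul]

/-- **A straight path**: going `|z₀|` steps along the first axis and then `|z₁|` along the second
reaches `z`, so `c_{|z₀| + |z₁|}(z) ≥ 1`. [folklore] -/
theorem one_le_count_natAbs (z : Site 2) : 1 ≤ count 2 (Int.natAbs (z 0) + Int.natAbs (z 1)) z := by
  classical
  rw [count]
  refine Finset.card_pos.2 ⟨Fin.append (fun _ : Fin (Int.natAbs (z 0)) => (((0 : Fin 2), decide (0 ≤ z 0)) : Dir 2))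
    (fun _ : Fin (Int.natAbs (z 1)) => (((1 : Fin 2), decide (0 ≤ z 1)) : Dir 2)), ?_⟩
  rw [Finset.mem_filter]
  refine ⟨Finset.mem_univ _, ?_⟩
  rw [endpoint_append, endpoint_const, endpoint_const]
  have e00 : (stepVec (((0 : Fin 2), decide (0 ≤ z 0)) : Dir 2)) 0 = if 0 ≤ z 0 then 1 else -1 := by
    by_cases h : 0 ≤ z 0 <;> simp [stepVec, h]
  have e01 : (stepVec (((0 : Fin 2), decide (0 ≤ z 0)) : Dir 2)) 1 = 0 := by
    by_cases h : 0 ≤ z 0 <;> simp [stepVec, h]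
  have e10 : (stepVec (((1 : Fin 2), decide (0 ≤ z 1)) : Dir 2)) 0 = 0 := by
    by_cases h : 0 ≤ z 1 <;> simp [stepVec, h]
  have e11 : (stepVec (((1 : Fin 2), decide (0 ≤ z 1)) : Dir 2)) 1 = if 0 ≤ z 1 then 1 else -1 := by
    by_cases h : 0 ≤ z 1 <;> simp [stepVec, h]
  funext c
  fin_cases c
  · show ((Int.natAbs (z 0) : ℕ) : ℤ) • stepVec (((0 : Fin 2), decide (0 ≤ z 0)) : Dir 2) 0 +
        ((Int.natAbs (z 1) : ℕ) : ℤ) • stepVec (((1 : Fin 2), decide (0 ≤ z 1)) : Dir 2) 0 = z 0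
    rw [e00, e10, smul_zero, add_zero, Int.natCast_natAbs, smul_eq_mul]
    by_cases h : 0 ≤ z 0
    · rw [if_pos h, abs_of_nonneg h, mul_one]
    · rw [if_neg h, abs_of_neg (not_le.1 h)]
      ring
  · show ((Int.natAbs (z 0) : ℕ) : ℤ) • stepVec (((0 : Fin 2), decide (0 ≤ z 0)) : Dir 2) 1 +
        ((Int.natAbs (z 1) : ℕ) : ℤ) • stepVec (((1 : Fin 2), decide (0 ≤ z 1)) : Dir 2) 1 = z 1
    rw [e01, e11, smul_zero, zero_add, Int.natCast_natAbs, smul_eq_mul]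
    by_cases h : 0 ≤ z 1
    · rw [if_pos h, abs_of_nonneg h, mul_one]
    · rw [if_neg h, abs_of_neg (not_le.1 h)]
      ring

/-! ### The killed Green function at distance `r` -/

/-- `e ≤ 4`, so `(1/4)^a ≤ e^{-a}`. [folklore] -/
theorem quarter_pow_le_exp_neg (a : ℕ) : (1 / 4 : ℝ) ^ a ≤ Real.exp (-(a : ℝ)) := by
  have h1 : Real.exp 1 ≤ 4 := by
    have := Real.exp_one_lt_d9
    linarith
  have h2 : (1 / 4 : ℝ) ≤ Real.exp (-1) := by
    rw [Real.exp_neg, one_div]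
    exact inv_anti₀ (Real.exp_pos 1) h1
  have h3 : Real.exp (-(a : ℝ)) = Real.exp (-1) ^ a := by
    rw [← Real.exp_nat_mul]
    congr 1
    ring
  rw [h3]
  exact pow_le_pow_left₀ (by norm_num) h2 a

/-- The transition probability of the tree, `prob 2 i z = c_i(z)/4^i`, unfolded. [folklore] -/
theorem prob_two_eq (i : ℕ) (z : Site 2) : prob 2 i z = (count 2 i z : ℝ) / 4 ^ i := by
  rw [prob]
  norm_num

/-- **The killed Green function at distance `r`** (Lawler's (3.27), finite counting form): for
`0 ≤ λ ≤ 1`, `|z|² ≤ r²` and a horizon `L ≥ r²/32 + 1200`,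
`Σ_{i ≤ L} λ^i p_i(z) ≥ 4^{-2000} · λ^{r²/32 + 1200}`. For `r ≥ 600` the `q = ⌊r²/256⌋` times
`i = 2j + p`, `2q ≤ j < 3q` (`p` the parity of `z₀ + z₁`) each contribute
`≥ λ^{r²/32+1200} e^{-261}/(12 q)` by `count_two_ge`; for `r < 600` the straight path of length
`|z₀| + |z₁| ≤ 2r < 1200` contributes `≥ λ^{1200} 4^{-1200}`. [cite: Lawler1991, (3.27)] -/
theorem sum_pow_mul_prob_ge {lam : ℝ} (hl0 : 0 ≤ lam) (hl1 : lam ≤ 1) (z : Site 2) (r : ℕ)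
    (hr : (z 0) ^ 2 + (z 1) ^ 2 ≤ (r : ℤ) ^ 2) (L : ℕ) (hL : r ^ 2 / 32 + 1200 ≤ L) :
    (1 / 4 : ℝ) ^ 2000 * lam ^ (r ^ 2 / 32 + 1200) ≤
      ∑ i ∈ Finset.range (L + 1), lam ^ i * prob 2 i z := by
  have hz0 : |z 0| ≤ r := abs_le_of_sq_le_sq (by nlinarith [sq_nonneg (z 1)]) (by positivity)
  have hz1 : |z 1| ≤ r := abs_le_of_sq_le_sq (by nlinarith [sq_nonneg (z 0)]) (by positivity)
  have hnonneg : ∀ i ∈ Finset.range (L + 1), 0 ≤ lam ^ i * prob 2 i z :=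
    fun i _ => mul_nonneg (pow_nonneg hl0 i) (prob_nonneg i z)
  set T : ℕ := r ^ 2 / 32 + 1200 with hT
  by_cases hsmall : r < 600
  · -- one straight path of length `|z₀| + |z₁| ≤ 2r < 1200`
    set i₀ : ℕ := Int.natAbs (z 0) + Int.natAbs (z 1) with hi₀
    have hi₀r : i₀ ≤ 2 * r := by
      have h0 : (Int.natAbs (z 0) : ℤ) ≤ r := by rw [Int.natCast_natAbs]; exact hz0
      have h1 : (Int.natAbs (z 1) : ℤ) ≤ r := by rw [Int.natCast_natAbs]; exact hz1
      omega
    have hi₀T : i₀ ≤ T := by omega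
    have hi₀L : i₀ ∈ Finset.range (L + 1) := Finset.mem_range.2 (by omega)
    have hterm : (1 / 4 : ℝ) ^ 2000 * lam ^ T ≤ lam ^ i₀ * prob 2 i₀ z := by
      have hc : (1 : ℝ) ≤ count 2 i₀ z := by exact_mod_cast one_le_count_natAbs z
      have hp : (1 / 4 : ℝ) ^ i₀ ≤ prob 2 i₀ z := by
        rw [prob_two_eq, le_div_iff₀ (by positivity), one_div_pow, div_mul_cancel₀ _ (by positivity)]
        exact hc
      have h1 : lam ^ T ≤ lam ^ i₀ := pow_le_pow_of_le_one hl0 hl1 hi₀T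
      have h2 : (1 / 4 : ℝ) ^ 2000 ≤ (1 / 4 : ℝ) ^ i₀ :=
        pow_le_pow_of_le_one (by norm_num) (by norm_num) (by omega)
      calc (1 / 4 : ℝ) ^ 2000 * lam ^ T ≤ (1 / 4 : ℝ) ^ i₀ * lam ^ i₀ :=
            mul_le_mul h2 h1 (pow_nonneg hl0 _) (by positivity)
        _ = lam ^ i₀ * (1 / 4 : ℝ) ^ i₀ := mul_comm _ _
        _ ≤ lam ^ i₀ * prob 2 i₀ z := mul_le_mul_of_nonneg_left hp (pow_nonneg hl0 _)
    exact hterm.trans (Finset.single_le_sum hnonneg hi₀L)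
  · -- the window `i = 2j + p`, `2q ≤ j < 3q`
    have hr600 : 600 ≤ r := not_lt.1 hsmall
    set X : ℕ := r ^ 2 with hX
    set q : ℕ := X / 256 with hq
    have hXr : 600 * r ≤ X := by rw [hX, sq]; exact Nat.mul_le_mul_right r hr600
    have hX0 : 360000 ≤ X := le_trans (by norm_num) (le_trans (Nat.mul_le_mul_left 600 hr600) hXr)
    have hq1 : 1 ≤ q := by omega
    set u : ℤ := z 0 + z 1 with hu
    set p : ℕ := (u % 2).toNat with hp
    have hpu : (p : ℤ) = u % 2 := by rw [hp, Int.toNat_of_nonneg (Int.emod_nonneg _ two_ne_zero)]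
    have hp1 : p ≤ 1 := by
      have := Int.emod_two_eq_zero_or_one u
      omega
    set W : Finset ℕ := (Finset.Ico (2 * q) (3 * q)).image fun j => 2 * j + p with hW
    have hWcard : #W = q := by
      rw [hW, Finset.card_image_of_injective _ fun a b h => by simpa using h, Nat.card_Ico]
      omega
    have hmemW : ∀ i ∈ W, ∃ j, 2 * q ≤ j ∧ j < 3 * q ∧ i = 2 * j + p := by
      intro i hi
      rw [hW, Finset.mem_image] at hi
      obtain ⟨j, hj, rfl⟩ := hi
      exact ⟨j, (Finset.mem_Ico.1 hj).1, (Finset.mem_Ico.1 hj).2, rfl⟩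
    have hWsub : W ⊆ Finset.range (L + 1) := by
      intro i hi
      obtain ⟨j, hj1, hj2, rfl⟩ := hmemW i hi
      rw [Finset.mem_range]
      omega
    -- the per-term bound
    have hterm : ∀ i ∈ W, lam ^ T * (Real.exp (-261) / (12 * q)) ≤ lam ^ i * prob 2 i z := by
      intro i hi
      obtain ⟨j, hj1, hj2, hij⟩ := hmemW i hi
      have hi4q : 4 * q ≤ i := by omega
      have hi6q : i + 1 ≤ 6 * q := by omega
      have hiT : i ≤ T := by omega
      have hi1 : 1 ≤ i := by omega
      -- hypotheses of `count_two_ge`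
      have hpar : Even ((i : ℤ) + (z 0 + z 1)) := by
        refine ⟨(j : ℤ) + p + u / 2, ?_⟩
        have hiz : (i : ℤ) = 2 * j + p := by exact_mod_cast hij
        omega
      have h8r : 8 * (r : ℤ) + 6 ≤ (i : ℤ) := by
        have h1 : 8 * r + 6 ≤ 4 * q := by omega
        have h2 : 8 * r + 6 ≤ i := by omega
        exact_mod_cast h2
      have hu4 : 4 * |z 0 + z 1| + 6 ≤ (i : ℤ) := by
        have := abs_add_le (z 0) (z 1)
        linarith
      have hv4 : 4 * |z 0 - z 1| + 6 ≤ (i : ℤ) := by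
        have := abs_sub (z 0) (z 1)
        linarith
      have hcount := count_two_ge hi1 z hpar hu4 hv4
      -- the exponent: `4|z|²/i ≤ 257`
      have hiR : (0 : ℝ) < (i : ℝ) := by exact_mod_cast hi1
      have hexp : Real.exp (-257) ≤ Real.exp (-(4 * ((z 0 : ℝ) ^ 2 + (z 1 : ℝ) ^ 2) / i)) := by
        refine Real.exp_le_exp.2 ?_
        rw [neg_le_neg_iff, div_le_iff₀ hiR]
        have h1 : 4 * X ≤ 257 * i := by omega
        have h2 : 4 * ((r : ℝ) ^ 2) ≤ 257 * (i : ℝ) := by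
          have : ((4 * X : ℕ) : ℝ) ≤ ((257 * i : ℕ) : ℝ) := by exact_mod_cast h1
          push_cast [hX] at this
          exact this
        have h3 := (Int.cast_le (R := ℝ)).2 hr
        push_cast at h3
        linarith
      -- assemble `prob ≥ e^{-261}/(12q)`
      have hprob : Real.exp (-261) / (12 * q) ≤ prob 2 i z := by
        rw [prob_two_eq, le_div_iff₀ (by positivity)]
        have h6 : 2 * ((i : ℝ) + 1) ≤ 12 * q := by
          have : ((2 * (i + 1) : ℕ) : ℝ) ≤ ((12 * q : ℕ) : ℝ) := by exact_mod_cast (by omega)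
          push_cast at this
          linarith
        have hq0 : (0 : ℝ) < 12 * q := by positivity
        calc Real.exp (-261) / (12 * q) * 4 ^ i
            ≤ Real.exp (-261) / (2 * ((i : ℝ) + 1)) * 4 ^ i := by
              gcongr
          _ = 4 ^ i * Real.exp (-4) * Real.exp (-257) / (2 * ((i : ℝ) + 1)) := by
              rw [show (-261 : ℝ) = -4 + -257 by norm_num, Real.exp_add]
              ring
          _ ≤ 4 ^ i * Real.exp (-4) *
                Real.exp (-(4 * ((z 0 : ℝ) ^ 2 + (z 1 : ℝ) ^ 2) / i)) / (2 * ((i : ℝ) + 1)) := by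
              gcongr
          _ ≤ count 2 i z := hcount
      have hlam : lam ^ T ≤ lam ^ i := pow_le_pow_of_le_one hl0 hl1 hiT
      exact mul_le_mul hlam hprob (by positivity) (pow_nonneg hl0 _)
    -- sum over the window
    have hconst : (1 / 4 : ℝ) ^ 2000 ≤ Real.exp (-261) / 12 := by
      have h1 : (1 / 4 : ℝ) ^ 261 ≤ Real.exp (-261) := by exact_mod_cast quarter_pow_le_exp_neg 261
      have h2 : (1 / 4 : ℝ) ^ 1739 ≤ 1 / 12 := by
        calc (1 / 4 : ℝ) ^ 1739 ≤ (1 / 4 : ℝ) ^ 2 := pow_le_pow_of_le_one (by norm_num) (by norm_num) (by norm_num)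
          _ ≤ 1 / 12 := by norm_num
      calc (1 / 4 : ℝ) ^ 2000 = (1 / 4 : ℝ) ^ 261 * (1 / 4 : ℝ) ^ 1739 := by rw [← pow_add]
        _ ≤ Real.exp (-261) * (1 / 12) := mul_le_mul h1 h2 (by positivity) (Real.exp_pos _).le
        _ = Real.exp (-261) / 12 := by ring
    have hq0 : (0 : ℝ) < q := by exact_mod_cast hq1
    calc (1 / 4 : ℝ) ^ 2000 * lam ^ T ≤ Real.exp (-261) / 12 * lam ^ T :=
          mul_le_mul_of_nonneg_right hconst (pow_nonneg hl0 _)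
      _ = ∑ _i ∈ W, lam ^ T * (Real.exp (-261) / (12 * q)) := by
          rw [Finset.sum_const, hWcard, nsmul_eq_mul]
          field_simp
      _ ≤ ∑ i ∈ W, lam ^ i * prob 2 i z := Finset.sum_le_sum hterm
      _ ≤ ∑ i ∈ Finset.range (L + 1), lam ^ i * prob 2 i z :=
          Finset.sum_le_sum_of_subset_of_nonneg hWsub fun i hi _ => hnonneg i hi

end PlaneNonIntersection

end Literature.Probability.RandomPlanarGeometry

end
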